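import Literature.NumberTheory.LFunctions.RiemannXi
import Mathlib.Analysis.Complex.PhragmenLindelof
import HarnessLib

/-!
# H-RIG along route B″ — file 5/7 of the split of `HandoffHRig` (handoff-idea-3 gen 26)

S5.A the strip divisor `cs` + S5.B `global_bound` (vertical-strip Phragmén–Lindelöf).
See the module docstring of `HandoffHRig.lean` (the last file) for the theorem `hRig_holds (D : ℕ) : HRig D`,
the route B″ and the references.  Nothing in this file bears on the truth of RH. [folklore]
-/

set_option linter.dupNamespace false

noncomputable section

open Complex MeasureTheory Set Filter Asymptotics
open scoped Real Topology
open Literature.NumberTheory.LFunctions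

namespace Summit.RiemannHypothesis.RiemannHypothesis.Theorems.HandoffHRig

/-! ### S5 — the Phragmén–Lindelöf synthesis — PROVED (no sorry).
(B) STRIP: `f = m / ((s+2)^N cs(s))`, `cs(s) = e^{iu} + e^{−iu}`, `u = (π/4)(s − ½)` (`= 2cos u`;
`Re cs = (e^{−b}+e^{b}) cos a ≥ cos(3π/8) e^{(π/4)|τ|}` on `−1 ≤ σ ≤ 2`, `‖cs‖ ≤ 2e^{(π/4)|τ|}`), bounded
by `K⁺4^N/cos(3π/8)` on `σ = −1, 2` (exterior clauses) and of admissible growth inside (`StripGrowth`,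
`c < π/3 = π/width`) ⇒ `PhragmenLindelof.vertical_strip` ⇒ the GLOBAL bound
`‖m(s)‖ ≤ K₂(1+‖s‖)^N e^{(π/4)|τ|}`.  (C) UPPER HALF-PLANE: `G_ε(s) = m(s) e^{iεs} (s+i)^{−N}`; for
`f(z) = G_ε(½ + z)`: S4 on the sector `κ|re z| < im z` with `κ = min(α₃(ε), α₄(ε), 1)` (rays: the two
thin-sector clauses for `|x| ≥ 3/2`, the global bound for `|x| < 3/2`; growth order `1`) ⇒
`‖G_ε(½+iy)‖ ≤ C₂ = K₂e^{3π/8}2^N` (independent of `ε`); then `PhragmenLindelof.quadrant_I/II`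
(real axis: the global bound at `τ = 0`) ⇒ `‖G_ε‖ ≤ C₂` on `im s ≥ 0` ⇒ `ε → 0⁺` (`le_of_tendsto`):
`‖m(s)‖ ≤ C₂‖s+i‖^N ≤ C₂(1+‖s‖)^N`.  (D) LOWER HALF-PLANE: the same for `m(1 − s)` (the hypotheses
are symmetric under `s ↦ 1 − s` up to `2^N`). -/

/-! ### S5.A The strip divisor `cs(s) = e^{iu} + e^{-iu}`, `u = (π/4)(s − ½)` (= `2cos u`) -/

/-- `u(s) = (π/4)(s − ½)`. -/
def uu (s : ℂ) : ℂ := ((π / 4 : ℝ) : ℂ) * (s - 1 / 2)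

/-- `cs(s) = e^{iu} + e^{−iu}`. -/
def cs (s : ℂ) : ℂ := exp (I * uu s) + exp (-(I * uu s))

/-- Real part of `u(s)`. -/
theorem uu_re (s : ℂ) : (uu s).re = π / 4 * (s.re - 1 / 2) := by
  simp [uu]

/-- Imaginary part of `u(s)`. -/
theorem uu_im (s : ℂ) : (uu s).im = π / 4 * s.im := by
  simp [uu]

/-- `u` is entire. -/
theorem differentiable_uu : Differentiable ℂ uu :=
  (differentiable_const _).mul (differentiable_id.sub (differentiable_const _))

/-- `cs` is entire. -/
theorem differentiable_cs : Differentiable ℂ cs :=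
  (((differentiable_const _).mul differentiable_uu).cexp).add
    (((differentiable_const _).mul differentiable_uu).neg.cexp)

/-- `‖cs s‖ ≤ 2 e^{(π/4)|τ|}`. -/
theorem norm_cs_le (s : ℂ) : ‖cs s‖ ≤ 2 * Real.exp (π / 4 * |s.im|) := by
  have h1 : ‖exp (I * uu s)‖ ≤ Real.exp (π / 4 * |s.im|) := by
    rw [norm_exp]
    apply Real.exp_le_exp.2
    have : (I * uu s).re = -(π / 4 * s.im) := by simp [uu_im]
    rw [this]
    have := neg_abs_le (s.im)
    nlinarith [Real.pi_pos, le_abs_self s.im]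
  have h2 : ‖exp (-(I * uu s))‖ ≤ Real.exp (π / 4 * |s.im|) := by
    rw [norm_exp]
    apply Real.exp_le_exp.2
    have : (-(I * uu s)).re = π / 4 * s.im := by simp [uu_im]
    rw [this]
    nlinarith [Real.pi_pos, le_abs_self s.im]
  calc ‖cs s‖ ≤ ‖exp (I * uu s)‖ + ‖exp (-(I * uu s))‖ := norm_add_le _ _
    _ ≤ _ := by linarith

/- LANDING NOTE (theory-1 gen19): idea-3 g26's helper `cos_three_pi_div_eight_pos : 0 < cos(3π/8)` restated a
landed Literature lemma of another topic (gate `dedup.landed`); rather than import that module the three uses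
below carry the one-line proof `Real.cos_pos_of_mem_Ioo` inline. -/

/-- LOWER BOUND on the closed strip: `cos(3π/8) e^{(π/4)|τ|} ≤ ‖cs s‖` for `−1 ≤ σ ≤ 2`
(via `Re cs = (e^{−b} + e^{b}) cos a ≥ e^{|b|} cos a`). -/
theorem norm_cs_ge {s : ℂ} (h1 : -1 ≤ s.re) (h2 : s.re ≤ 2) :
    Real.cos (3 * π / 8) * Real.exp (π / 4 * |s.im|) ≤ ‖cs s‖ := by
  have ha : |π / 4 * (s.re - 1 / 2)| ≤ 3 * π / 8 := by
    rw [abs_le]; constructor <;> nlinarith [Real.pi_pos]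
  have hcos : Real.cos (3 * π / 8) ≤ Real.cos (π / 4 * (s.re - 1 / 2)) := by
    rw [← Real.cos_abs (π / 4 * (s.re - 1 / 2))]
    exact Real.cos_le_cos_of_nonneg_of_le_pi (abs_nonneg _) (by nlinarith [Real.pi_pos]) ha
  have hc0 : 0 < Real.cos (3 * π / 8) :=
    (Real.cos_pos_of_mem_Ioo ⟨by nlinarith [Real.pi_pos], by nlinarith [Real.pi_pos]⟩)
  have hre : (cs s).re = (Real.exp (-(π / 4 * s.im)) + Real.exp (π / 4 * s.im)) *
      Real.cos (π / 4 * (s.re - 1 / 2)) := by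
    simp only [cs, add_re, exp_re]
    have e1 : (I * uu s).re = -(π / 4 * s.im) := by simp [uu_im]
    have e2 : (I * uu s).im = π / 4 * (s.re - 1 / 2) := by simp [uu_re]
    have e3 : (-(I * uu s)).re = π / 4 * s.im := by simp [uu_im]
    have e4 : (-(I * uu s)).im = -(π / 4 * (s.re - 1 / 2)) := by simp [uu_re]
    rw [e1, e2, e3, e4, Real.cos_neg]; ring
  have hsum : Real.exp (π / 4 * |s.im|) ≤ Real.exp (-(π / 4 * s.im)) + Real.exp (π / 4 * s.im) := by
    rcases le_or_gt 0 s.im with h | h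
    · rw [abs_of_nonneg h]; linarith [Real.exp_pos (-(π / 4 * s.im))]
    · rw [abs_of_neg h, show π / 4 * -s.im = -(π / 4 * s.im) by ring]
      linarith [Real.exp_pos (π / 4 * s.im)]
  calc Real.cos (3 * π / 8) * Real.exp (π / 4 * |s.im|)
      ≤ Real.cos (π / 4 * (s.re - 1 / 2)) * (Real.exp (-(π / 4 * s.im)) + Real.exp (π / 4 * s.im)) :=
        mul_le_mul hcos hsum (by positivity) (hc0.le.trans hcos)
    _ = (cs s).re := by rw [hre]; ring
    _ ≤ ‖cs s‖ := re_le_norm _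

/-- `cs` has no zero on the closed strip `-1 ≤ re s ≤ 2`. -/
theorem cs_ne_zero {s : ℂ} (h1 : -1 ≤ s.re) (h2 : s.re ≤ 2) : cs s ≠ 0 := by
  intro h
  have := norm_cs_ge h1 h2
  rw [h, norm_zero] at this
  have : 0 < Real.cos (3 * π / 8) * Real.exp (π / 4 * |s.im|) :=
    mul_pos (Real.cos_pos_of_mem_Ioo ⟨by nlinarith [Real.pi_pos], by nlinarith [Real.pi_pos]⟩) (Real.exp_pos _)
  linarith

/-! ### S5.B The vertical-strip step: `StripGrowth` + the two exterior clauses ⇒ a GLOBAL bound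
`‖m(s)‖ ≤ K₂ (1+‖s‖)^N e^{(π/4)|τ|}`. -/

/-- `1 + ‖s‖ ≤ 4‖s + 2‖` and `1 ≤ ‖s+2‖` for `σ ≥ −1`. -/
theorem norm_add_two_ge {s : ℂ} (h1 : -1 ≤ s.re) : 1 ≤ ‖s + 2‖ ∧ 1 + ‖s‖ ≤ 4 * ‖s + 2‖ := by
  have hA : 1 ≤ ‖s + 2‖ := by
    have : (s + 2).re = s.re + 2 := by simp
    linarith [re_le_norm (s + 2)]
  refine ⟨hA, ?_⟩
  have : ‖s‖ ≤ ‖s + 2‖ + ‖(2 : ℂ)‖ := by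
    have := norm_sub_le (s + 2) (2 : ℂ); simpa using this
  have h2 : ‖(2 : ℂ)‖ = 2 := by simp
  rw [h2] at this
  linarith

/-- `‖s + 2‖ ≤ 2(1 + ‖s‖)`. -/
theorem norm_add_two_le (s : ℂ) : ‖s + 2‖ ≤ 2 * (1 + ‖s‖) := by
  have : ‖s + 2‖ ≤ ‖s‖ + ‖(2 : ℂ)‖ := norm_add_le _ _
  have h2 : ‖(2 : ℂ)‖ = 2 := by simp
  rw [h2] at this; linarith [norm_nonneg s]

/-- The STRIP STEP. -/
theorem global_bound {m : ℂ → ℂ} {N : ℕ} (hm : Differentiable ℂ m)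
    (hS : (∃ c : ℝ, c < π / 3 ∧ ∃ A : ℝ, ∀ s : ℂ, -1 ≤ s.re → s.re ≤ 2 →
        ‖m s‖ ≤ Real.exp (A * Real.exp (c * |s.im|)))) {K : ℝ}
    (hR : ∀ s : ℂ, 2 ≤ s.re → ‖m s‖ ≤ K * (1 + ‖s‖) ^ N * Real.exp (π / 4 * |s.im|))
    (hL : ∀ s : ℂ, s.re ≤ -1 → ‖m s‖ ≤ K * (1 + ‖s‖) ^ N * Real.exp (π / 4 * |s.im|)) :
    ∃ K₂ : ℝ, 0 ≤ K₂ ∧ K ≤ K₂ ∧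
      ∀ s : ℂ, ‖m s‖ ≤ K₂ * (1 + ‖s‖) ^ N * Real.exp (π / 4 * |s.im|) := by
  obtain ⟨c, hc, A, hA⟩ := hS
  set c₀ : ℝ := Real.cos (3 * π / 8) with hc₀
  have hc0 : 0 < c₀ :=
    (Real.cos_pos_of_mem_Ioo ⟨by nlinarith [Real.pi_pos], by nlinarith [Real.pi_pos]⟩)
  set K' : ℝ := max K 0 with hK'
  have hK'0 : 0 ≤ K' := le_max_right _ _
  have hKK' : K ≤ K' := le_max_left _ _
  -- the quotient
  set f : ℂ → ℂ := fun s => m s / ((s + 2) ^ N * cs s) with hf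
  have hden : ∀ s : ℂ, -1 ≤ s.re → s.re ≤ 2 → (s + 2) ^ N * cs s ≠ 0 := by
    intro s h1 h2
    apply mul_ne_zero (pow_ne_zero _ ?_) (cs_ne_zero h1 h2)
    intro h; have := congrArg Complex.re h; simp at this; linarith
  -- (a) DiffContOnCl on the open strip
  have hclos : closure (re ⁻¹' Ioo (-1 : ℝ) 2) = re ⁻¹' Icc (-1 : ℝ) 2 := by
    rw [closure_preimage_re, closure_Ioo (by norm_num)]
  have hfd : DiffContOnCl ℂ f (re ⁻¹' Ioo (-1 : ℝ) 2) := by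
    apply DifferentiableOn.diffContOnCl
    rw [hclos]
    intro s hs
    have hs' : -1 ≤ s.re ∧ s.re ≤ 2 := hs
    apply DifferentiableAt.differentiableWithinAt
    have hd1 : DifferentiableAt ℂ m s := hm.differentiableAt
    have hd2 : DifferentiableAt ℂ (fun s => (s + 2) ^ N * cs s) s :=
      (((differentiable_id.add (differentiable_const _)).pow N).mul
        differentiable_cs).differentiableAt
    simp only [hf]
    exact hd1.div hd2 (hden s hs'.1 hs'.2)
  -- the basic estimate of `‖f‖` from an estimate of `‖m‖`
  have hf_le : ∀ s : ℂ, -1 ≤ s.re → s.re ≤ 2 → ∀ X : ℝ, 0 ≤ X →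
      ‖m s‖ ≤ X * ‖s + 2‖ ^ N * Real.exp (π / 4 * |s.im|) → ‖f s‖ ≤ X / c₀ := by
    intro s h1 h2 X hX hms
    have hd := hden s h1 h2
    have hdpos : 0 < ‖(s + 2) ^ N * cs s‖ := norm_pos_iff.2 hd
    simp only [hf]
    rw [norm_div, div_le_iff₀ hdpos, norm_mul, norm_pow]
    have hcs := norm_cs_ge h1 h2
    calc ‖m s‖ ≤ X * ‖s + 2‖ ^ N * Real.exp (π / 4 * |s.im|) := hms
      _ = X / c₀ * (‖s + 2‖ ^ N * (c₀ * Real.exp (π / 4 * |s.im|))) := by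
          field_simp
      _ ≤ X / c₀ * (‖s + 2‖ ^ N * ‖cs s‖) := by gcongr
  -- (b) growth inside the strip
  have hB : ∃ c' < π / (2 - (-1 : ℝ)), ∃ B, f =O[comap (_root_.abs ∘ im) atTop ⊓ 𝓟 (re ⁻¹' Ioo (-1:ℝ) 2)]
      fun z => Real.exp (B * Real.exp (c' * |z.im|)) := by
    refine ⟨c, by norm_num; linarith, max A 0, ?_⟩
    apply IsBigO.of_bound (1 / c₀)
    rw [eventually_inf_principal]
    refine Eventually.of_forall fun s hs => ?_
    have hs' : -1 < s.re ∧ s.re < 2 := hs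
    rw [Real.norm_of_nonneg (Real.exp_pos _).le]
    have h12 := norm_add_two_ge hs'.1.le
    have hms : ‖m s‖ ≤ Real.exp (max A 0 * Real.exp (c * |s.im|)) * ‖s + 2‖ ^ N *
        Real.exp (π / 4 * |s.im|) := by
      have hA' := hA s hs'.1.le hs'.2.le
      have e1 : Real.exp (A * Real.exp (c * |s.im|)) ≤ Real.exp (max A 0 * Real.exp (c * |s.im|)) :=
        Real.exp_le_exp.2 (mul_le_mul_of_nonneg_right (le_max_left _ _) (Real.exp_pos _).le)
      have e2 : (1 : ℝ) ≤ ‖s + 2‖ ^ N * Real.exp (π / 4 * |s.im|) := by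
        have : (1:ℝ) ≤ ‖s + 2‖ ^ N := one_le_pow₀ h12.1
        have : (1:ℝ) ≤ Real.exp (π / 4 * |s.im|) := Real.one_le_exp (by positivity)
        nlinarith
      calc ‖m s‖ ≤ Real.exp (max A 0 * Real.exp (c * |s.im|)) * 1 := by rw [mul_one]; exact hA'.trans e1
        _ ≤ Real.exp (max A 0 * Real.exp (c * |s.im|)) * (‖s + 2‖ ^ N * Real.exp (π / 4 * |s.im|)) := by
            gcongr
        _ = _ := by ring
    have := hf_le s hs'.1.le hs'.2.le _ (Real.exp_pos _).le hms
    calc ‖f s‖ ≤ Real.exp (max A 0 * Real.exp (c * |s.im|)) / c₀ := this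
      _ = 1 / c₀ * Real.exp (max A 0 * Real.exp (c * |s.im|)) := by ring
  -- (c) the boundary lines
  have hbdry : ∀ s : ℂ, (s.re = -1 ∨ s.re = 2) → ‖f s‖ ≤ K' * 4 ^ N / c₀ := by
    intro s hs
    have h1 : -1 ≤ s.re := by rcases hs with h | h <;> norm_num [h]
    have h2 : s.re ≤ 2 := by rcases hs with h | h <;> norm_num [h]
    have h12 := norm_add_two_ge h1
    apply hf_le s h1 h2 _ (by positivity)
    have hm0 : ‖m s‖ ≤ K * (1 + ‖s‖) ^ N * Real.exp (π / 4 * |s.im|) := by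
      rcases hs with h | h
      · exact hL s (by rw [h])
      · exact hR s (by rw [h])
    have hpow : (1 + ‖s‖) ^ N ≤ 4 ^ N * ‖s + 2‖ ^ N := by
      rw [← mul_pow]; exact pow_le_pow_left₀ (by positivity) h12.2 N
    calc ‖m s‖ ≤ K * (1 + ‖s‖) ^ N * Real.exp (π / 4 * |s.im|) := hm0
      _ ≤ K' * (1 + ‖s‖) ^ N * Real.exp (π / 4 * |s.im|) := by gcongr
      _ ≤ K' * (4 ^ N * ‖s + 2‖ ^ N) * Real.exp (π / 4 * |s.im|) := by gcongr
      _ = _ := by ring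
  -- (d) Phragmén–Lindelöf in the strip
  have hPL : ∀ s : ℂ, -1 ≤ s.re → s.re ≤ 2 → ‖f s‖ ≤ K' * 4 ^ N / c₀ := fun s h1 h2 =>
    PhragmenLindelof.vertical_strip hfd hB (fun z hz => hbdry z (Or.inl hz))
      (fun z hz => hbdry z (Or.inr hz)) h1 h2
  -- (e) back to `m`
  set K₂ : ℝ := max K' (K' * 4 ^ N / c₀ * 2 ^ (N + 1)) with hK₂
  refine ⟨K₂, hK'0.trans (le_max_left _ _), hKK'.trans (le_max_left _ _), fun s => ?_⟩
  have hfac : 0 ≤ (1 + ‖s‖) ^ N * Real.exp (π / 4 * |s.im|) := by positivity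
  rcases lt_or_ge s.re (-1) with hlt | hge
  · calc ‖m s‖ ≤ K * (1 + ‖s‖) ^ N * Real.exp (π / 4 * |s.im|) := hL s hlt.le
      _ ≤ K₂ * (1 + ‖s‖) ^ N * Real.exp (π / 4 * |s.im|) := by
          gcongr; exact hKK'.trans (le_max_left _ _)
  rcases lt_or_ge 2 s.re with hgt | hle
  · calc ‖m s‖ ≤ K * (1 + ‖s‖) ^ N * Real.exp (π / 4 * |s.im|) := hR s hgt.le
      _ ≤ K₂ * (1 + ‖s‖) ^ N * Real.exp (π / 4 * |s.im|) := by
          gcongr; exact hKK'.trans (le_max_left _ _)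
  -- inside the closed strip
  have hd := hden s hge hle
  have hfs := hPL s hge hle
  have hm_eq : m s = f s * ((s + 2) ^ N * cs s) := by
    simp only [hf]; rw [div_mul_cancel₀ _ hd]
  rw [hm_eq, norm_mul, norm_mul, norm_pow]
  have hcs := norm_cs_le s
  have h2le := norm_add_two_le s
  calc ‖f s‖ * (‖s + 2‖ ^ N * ‖cs s‖)
      ≤ (K' * 4 ^ N / c₀) * ((2 * (1 + ‖s‖)) ^ N * (2 * Real.exp (π / 4 * |s.im|))) := by
        gcongr
    _ = (K' * 4 ^ N / c₀ * 2 ^ (N + 1)) * (1 + ‖s‖) ^ N * Real.exp (π / 4 * |s.im|) := by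
        rw [mul_pow, pow_succ]; ring
    _ ≤ K₂ * (1 + ‖s‖) ^ N * Real.exp (π / 4 * |s.im|) := by
        gcongr; exact le_max_right _ _

end Summit.RiemannHypothesis.RiemannHypothesis.Theorems.HandoffHRig
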